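import Mathlib
import Summits.NavierStokesRegularity.OSWSelfSimilar.SheetNSLineLinearCoreTail
import HarnessLib

/-!
# The LINEAR CORE of the `a = 0` (CLM-point) profile equation on the NS-type line, part 2:
# decaying solutions of `εΩ″ = (c − h)Ω + (c/2)ξΩ′` with an `o(ξ⁻²)` tail vanish identically

HONEST FRAMING (cell ns-blowup GROUP B «PROFILE SEARCH», zone Z3 = the 1-D viscous gCLM/OSW sheet; human rulings
D-0035/D-0074): **one-variable real analysis about a LINEAR second-order ODE on `(0,∞)` with a continuous square-integrable
coefficient; 1-D MODEL bookkeeping; not Euler, not Navier–Stokes; «violates: none — MODEL».** Nothing here is a statement about NS.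

Continuing `SheetNSLineLinearCoreTail.lean` (first integral + tail bound `ξ²|Ω(ξ)| ≤ (2/c)T(ξ)`, `T(ξ) = ∫_ξ^∞|ηhΩ|`):
* `linearCore_eventually_zero` — since `T(ξ) ≤ (2/c)T(ξ)∫_ξ^∞|h|/η` and `∫_ξ^∞|h|/η ≤ δ‖h‖₂²/2 + (2δξ)⁻¹` (AM–GM, `h ∈ L²`),
  `T(ξ) ≤ T(ξ)/2` for `ξ ≥ ξ₁ := 16(‖h‖₂²+1)/c²`, hence `Ω ≡ 0` on `[ξ₁,∞)`;
* `linearCore_eqOn_zero` — backward Grönwall for the linear ODE (Mathlib `eq_zero_of_abs_deriv_le_mul_abs_self_of_eq_zero_right`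
  on the reversed vector `(Ω, Ω′)(ξ₁+1−s)`) continues the zero set down to every `ξ₀ > 0`: **`Ω ≡ 0` on `(0,∞)`**.
So: a `C²` solution on `(0,∞)` of `εΩ″ = (c − h)Ω + (c/2)ξΩ′` (`c, ε > 0`, `h ∈ C⁰ ∩ L²`, `ξhΩ ∈ L¹(0,∞)`) with `Ω → 0`,
`ξΩ′ → 0` and NO `ξ⁻²` TAIL (`ξ²Ω → 0`) is identically zero on `(0,∞)` — the decaying solutions of this equation are exactly the
`ξ⁻²`-tailed ones. The genuine `h = HΩ` is plugged in by `SheetNSLineCLMPointEmpty.lean` (census decl). Elementary proofs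
(AM–GM, Grönwall); tagged [new here — MODEL bookkeeping] / [folklore]. No definitions, no `def … : Prop` hypotheses, standard axioms.
bears_on: LADDER-NS N5 / zone Z3 row Z3-E12⁻ clause (i′) «the Schochet corner a = 0 is the divide» (CENSUS-Z3 v2.12 §0) → N1 linear
core. WHAT THIS IS NOT: not NS; not an existence statement; nothing about `a ≠ 0`.
-/

noncomputable section
open Set Filter Topology MeasureTheory
open scoped Real

namespace Summit.NavierStokesRegularity.OSWSelfSimilar
namespace SheetHalfLine

/-! ### Step 3: vanishing near `+∞` (`h ∈ L²` makes `∫_ξ^∞|h|/η` small) -/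

/-- AM–GM: `|x|/η ≤ (δ/2)x² + (2δ)⁻¹η⁻²` for `δ, η > 0`. [folklore] -/
theorem linearCore_abs_div_le_amgm {x η δ : ℝ} (hδ : 0 < δ) (hη : 0 < η) :
    |x| / η ≤ δ / 2 * x ^ 2 + 1 / (2 * δ) * (η ^ 2)⁻¹ := by
  have key : δ / 2 * x ^ 2 + 1 / (2 * δ) * (η ^ 2)⁻¹ - |x| / η = 1 / (2 * δ) * (δ * |x| - η⁻¹) ^ 2 := by
    rw [← sq_abs x]
    field_simp
    ring
  have : 0 ≤ 1 / (2 * δ) * (δ * |x| - η⁻¹) ^ 2 := by positivity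
  linarith

/-- **EVENTUAL VANISHING of the `a = 0` linear core.** In the setting of `linearCore_sq_mul_abs_le` with `h ∈ L²(ℝ)`:
with `S := ∫h²` and `ξ₁ := 16(S+1)/c²`, `Ω(ξ) = 0` for every `ξ ≥ ξ₁`. Proof: for `η ≥ ξ`, `η²|Ω(η)| ≤ (2/c)T(ξ)`
(`T(ξ) = ∫_ξ^∞|ηhΩ|`), so `T(ξ) ≤ (2/c)T(ξ)·∫_ξ^∞|h|/η ≤ (2/c)T(ξ)·(δS/2 + (2δξ)⁻¹) ≤ T(ξ)/2` with `δ = c/(4(S+1))`, whence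
`T(ξ) = 0` and `Ω(ξ) = 0`. [new here — MODEL bookkeeping] -/
theorem linearCore_eventually_zero {c ε : ℝ} {h Om dOm ddOm : ℝ → ℝ} (hc : 0 < c) (hε : 0 < ε) (hh : Continuous h)
    (hh2 : MemLp h 2) (hOm : ∀ ξ, HasDerivAt Om (dOm ξ) ξ) (hdOm : ∀ ξ, HasDerivAt dOm (ddOm ξ) ξ)
    (heq : ∀ ξ ∈ Ioi (0:ℝ), ε * ddOm ξ = c * Om ξ + c / 2 * ξ * dOm ξ - h ξ * Om ξ)
    (iH : IntegrableOn (fun ξ => ξ * (h ξ * Om ξ)) (Ioi 0))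
    (hOm0 : Tendsto Om atTop (𝓝 0)) (hdOm1 : Tendsto (fun R => R * dOm R) atTop (𝓝 0))
    (htail : Tendsto (fun R => R ^ 2 * Om R) atTop (𝓝 0)) :
    ∀ ξ, 16 * ((∫ η, h η ^ 2) + 1) / c ^ 2 ≤ ξ → Om ξ = 0 := by
  set S : ℝ := ∫ η, h η ^ 2 with hS
  have hS0 : 0 ≤ S := integral_nonneg fun η => sq_nonneg _
  have hh2i : Integrable (fun η => h η ^ 2) := hh2.integrable_sq
  set δ : ℝ := c / (4 * (S + 1)) with hδ
  have hδ0 : 0 < δ := by positivity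
  intro ξ hξ1
  have hξ1pos : 0 < 16 * (S + 1) / c ^ 2 := by positivity
  have hξ : 0 < ξ := hξ1pos.trans_le hξ1
  have hcΩ : Continuous Om := continuous_iff_continuousAt.mpr fun x => (hOm x).continuousAt
  -- `T(ξ)` and the pointwise bound on `[ξ, ∞)`
  set T : ℝ := ∫ η in Ioi ξ, |η * (h η * Om η)| with hT
  have hT0 : 0 ≤ T := setIntegral_nonneg measurableSet_Ioi fun η _ => abs_nonneg _
  have iHξ : IntegrableOn (fun η => η * (h η * Om η)) (Ioi ξ) := iH.mono_set (Ioi_subset_Ioi hξ.le)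
  have hpt : ∀ η ∈ Ioi ξ, η ^ 2 * |Om η| ≤ 2 / c * T := by
    intro η hη
    have hη0 : 0 < η := hξ.trans hη
    have h1 := linearCore_sq_mul_abs_le hc hε hh hOm hdOm heq iH hOm0 hdOm1 htail hη0
    refine h1.trans (mul_le_mul_of_nonneg_left ?_ (by positivity))
    exact setIntegral_mono_set iHξ.abs (ae_of_all _ fun s => abs_nonneg _) (ae_of_all _ (Ioi_subset_Ioi hη.le))
  -- `θ(ξ) = ∫_ξ^∞ |h|/η` is finite and small
  obtain ⟨hinvI, hinvval⟩ := linearCore_integral_Ioi_inv_sq hξ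
  have hdomI : IntegrableOn (fun η => δ / 2 * h η ^ 2 + 1 / (2 * δ) * (η ^ 2)⁻¹) (Ioi ξ) :=
    ((hh2i.integrableOn).const_mul (δ / 2)).add (hinvI.const_mul (1 / (2 * δ)))
  have hgmeas : AEStronglyMeasurable (fun η => |h η| / η) (volume.restrict (Ioi ξ)) := by
    refine ContinuousOn.aestronglyMeasurable ?_ measurableSet_Ioi
    refine continuousOn_of_forall_continuousAt fun η hη => ?_
    have hη0 : η ≠ 0 := (hξ.trans hη).ne'
    fun_prop (disch := assumption)
  have hgle : ∀ η ∈ Ioi ξ, |h η| / η ≤ δ / 2 * h η ^ 2 + 1 / (2 * δ) * (η ^ 2)⁻¹ :=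
    fun η hη => linearCore_abs_div_le_amgm hδ0 (hξ.trans hη)
  have hgI : IntegrableOn (fun η => |h η| / η) (Ioi ξ) := by
    refine Integrable.mono' hdomI hgmeas ?_
    filter_upwards [self_mem_ae_restrict measurableSet_Ioi] with η hη
    rw [Real.norm_eq_abs, abs_of_nonneg (div_nonneg (abs_nonneg _) (hξ.trans hη).le)]
    exact hgle η hη
  have hθ : ∫ η in Ioi ξ, |h η| / η ≤ δ / 2 * S + 1 / (2 * δ) * ξ⁻¹ := by
    refine (setIntegral_mono_on hgI hdomI measurableSet_Ioi hgle).trans ?_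
    rw [integral_add ((hh2i.integrableOn).const_mul (δ / 2)) (hinvI.const_mul (1 / (2 * δ))),
      integral_const_mul, integral_const_mul, hinvval]
    have : ∫ η in Ioi ξ, h η ^ 2 ≤ S := setIntegral_le_integral hh2i (ae_of_all _ fun η => sq_nonneg _)
    nlinarith
  -- the Grönwall-at-infinity inequality `T ≤ (2/c)·θ·T ≤ T/2`
  have hTle : T ≤ (∫ η in Ioi ξ, |h η| / η) * (2 / c * T) := by
    rw [← integral_mul_const]
    refine setIntegral_mono_on iHξ.abs (hgI.mul_const _) measurableSet_Ioi fun η hη => ?_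
    have hη0 : 0 < η := hξ.trans hη
    calc |η * (h η * Om η)| = |h η| / η * (η ^ 2 * |Om η|) := by
          rw [abs_mul, abs_mul, abs_of_pos hη0]
          field_simp
      _ ≤ |h η| / η * (2 / c * T) := mul_le_mul_of_nonneg_left (hpt η hη) (by positivity)
  have hcoef : (δ / 2 * S + 1 / (2 * δ) * ξ⁻¹) * (2 / c) ≤ 1 / 2 := by
    have h1 : δ / 2 * S * (2 / c) ≤ 1 / 4 := by
      have e1 : δ / 2 * S * (2 / c) = S / (4 * (S + 1)) := by
        rw [hδ]
        field_simp
      rw [e1, div_le_div_iff₀ (by positivity) (by positivity)]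
      nlinarith
    have h2 : 1 / (2 * δ) * ξ⁻¹ * (2 / c) ≤ 1 / 4 := by
      have hcδ : 1 / (2 * δ) * (2 / c) = 4 * (S + 1) / c ^ 2 := by
        rw [hδ]
        field_simp
      calc 1 / (2 * δ) * ξ⁻¹ * (2 / c) = (1 / (2 * δ) * (2 / c)) * ξ⁻¹ := by ring
        _ = 4 * (S + 1) / c ^ 2 * ξ⁻¹ := by rw [hcδ]
        _ ≤ 4 * (S + 1) / c ^ 2 * (16 * (S + 1) / c ^ 2)⁻¹ := by
            apply mul_le_mul_of_nonneg_left _ (by positivity)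
            exact inv_anti₀ hξ1pos hξ1
        _ = 1 / 4 := by field_simp; ring
    nlinarith
  have hThalf : T ≤ 1 / 2 * T := by
    calc T ≤ (∫ η in Ioi ξ, |h η| / η) * (2 / c * T) := hTle
      _ ≤ (δ / 2 * S + 1 / (2 * δ) * ξ⁻¹) * (2 / c * T) := mul_le_mul_of_nonneg_right hθ (by positivity)
      _ = (δ / 2 * S + 1 / (2 * δ) * ξ⁻¹) * (2 / c) * T := by ring
      _ ≤ 1 / 2 * T := mul_le_mul_of_nonneg_right hcoef hT0
  have hT00 : T = 0 := le_antisymm (by linarith) hT0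
  have h0 := (linearCore_sq_mul_abs_le hc hε hh hOm hdOm heq iH hOm0 hdOm1 htail hξ).trans_eq
    (by rw [← hT, hT00, mul_zero])
  have : ξ ^ 2 * |Om ξ| = 0 := le_antisymm h0 (by positivity)
  rcases mul_eq_zero.mp this with h' | h'
  · exact absurd h' (by positivity)
  · exact abs_eq_zero.mp h'

/-! ### Step 4: backward continuation by Grönwall for the linear ODE -/

/-- **THE LINEAR CORE OF THE CLM POINT: decaying solutions with an `o(ξ⁻²)` tail vanish.** Let `c, ε > 0`, `h : ℝ → ℝ`
continuous with `h ∈ L²(ℝ)`, and `Ω` a `C²` function (`Ω′ = dOm`, `Ω″ = ddOm` everywhere) solving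
`εΩ″ = cΩ + (c/2)ξΩ′ − h(ξ)Ω` on `(0,∞)`, with `ξh(ξ)Ω(ξ) ∈ L¹(0,∞)`, `Ω → 0`, `ξΩ′ → 0` and `ξ²Ω → 0` at `+∞`. Then
**`Ω ≡ 0` on `(0,∞)`**. (Steps 1–3 give `Ω ≡ 0` on `[ξ₁,∞)`; on `[ξ₀, ξ₁+1]` the reversed vector `(Ω, Ω′)(ξ₁+1−s)` solves a
linear system with bounded coefficients and vanishes at `s = 0`, so Mathlib's Grönwall lemma
`eq_zero_of_abs_deriv_le_mul_abs_self_of_eq_zero_right` makes it vanish.) [new here — MODEL bookkeeping] -/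
theorem linearCore_eqOn_zero {c ε : ℝ} {h Om dOm ddOm : ℝ → ℝ} (hc : 0 < c) (hε : 0 < ε) (hh : Continuous h)
    (hh2 : MemLp h 2) (hOm : ∀ ξ, HasDerivAt Om (dOm ξ) ξ) (hdOm : ∀ ξ, HasDerivAt dOm (ddOm ξ) ξ)
    (heq : ∀ ξ ∈ Ioi (0:ℝ), ε * ddOm ξ = c * Om ξ + c / 2 * ξ * dOm ξ - h ξ * Om ξ)
    (iH : IntegrableOn (fun ξ => ξ * (h ξ * Om ξ)) (Ioi 0))
    (hOm0 : Tendsto Om atTop (𝓝 0)) (hdOm1 : Tendsto (fun R => R * dOm R) atTop (𝓝 0))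
    (htail : Tendsto (fun R => R ^ 2 * Om R) atTop (𝓝 0)) :
    ∀ ξ ∈ Ioi (0:ℝ), Om ξ = 0 := by
  have hzero := linearCore_eventually_zero hc hε hh hh2 hOm hdOm heq iH hOm0 hdOm1 htail
  set ξ₁ : ℝ := 16 * ((∫ η, h η ^ 2) + 1) / c ^ 2 with hξ₁
  have hS0 : 0 ≤ ∫ η, h η ^ 2 := integral_nonneg fun η => sq_nonneg _
  have hξ₁pos : 0 < ξ₁ := by positivity
  intro ξ hξ
  have hξ0 : 0 < ξ := hξ
  by_cases hge : ξ₁ ≤ ξ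
  · exact hzero ξ hge
  rw [not_le] at hge
  -- continuity of `Ω`, `Ω′`
  have hcΩ : Continuous Om := continuous_iff_continuousAt.mpr fun x => (hOm x).continuousAt
  have hcdΩ : Continuous dOm := continuous_iff_continuousAt.mpr fun x => (hdOm x).continuousAt
  -- start point `ξ₂ = ξ₁ + 1`, where `Ω = Ω′ = 0`
  set ξ₂ : ℝ := ξ₁ + 1 with hξ₂
  have hOm2 : Om ξ₂ = 0 := hzero ξ₂ (by linarith)
  have hdOm2 : dOm ξ₂ = 0 := by
    have hev : Om =ᶠ[𝓝 ξ₂] fun _ => (0:ℝ) :=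
      Filter.eventuallyEq_of_mem (Ioi_mem_nhds (show ξ₁ < ξ₂ by linarith)) fun x hx => hzero x (le_of_lt hx)
    have h0 : HasDerivAt Om 0 ξ₂ := (hasDerivAt_const ξ₂ (0:ℝ)).congr_of_eventuallyEq hev
    exact (hOm ξ₂).unique h0
  -- a bound for `|h|` on `[ξ, ξ₂]`
  obtain ⟨B, hB⟩ := (isCompact_Icc (a := ξ) (b := ξ₂)).exists_bound_of_continuousOn hh.continuousOn
  have hB0 : 0 ≤ B := (norm_nonneg _).trans (hB ξ (left_mem_Icc.mpr (by linarith)))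
  -- the reversed vector and its derivative
  set K : ℝ := 1 + (c + B + c / 2 * ξ₂) / ε with hK
  have hK1 : 1 ≤ K := by
    have : 0 ≤ (c + B + c / 2 * ξ₂) / ε := by positivity
    linarith
  have hF : ∀ s, HasDerivAt (fun s => (Om (ξ₂ - s), dOm (ξ₂ - s))) (-dOm (ξ₂ - s), -ddOm (ξ₂ - s)) s := by
    intro s
    have hi : HasDerivAt (fun x : ℝ => ξ₂ - x) (-1) s := by simpa using (hasDerivAt_id s).const_sub ξ₂
    have h1 : HasDerivAt (fun x => Om (ξ₂ - x)) (-dOm (ξ₂ - s)) s := by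
      have := (hOm (ξ₂ - s)).comp s hi
      simpa [Function.comp_def] using this
    have h2 : HasDerivAt (fun x => dOm (ξ₂ - x)) (-ddOm (ξ₂ - s)) s := by
      have := (hdOm (ξ₂ - s)).comp s hi
      simpa [Function.comp_def] using this
    exact h1.prodMk h2
  have hFc : ContinuousOn (fun s => (Om (ξ₂ - s), dOm (ξ₂ - s))) (Icc 0 (ξ₂ - ξ)) :=
    (continuous_iff_continuousAt.mpr fun s => (hF s).continuousAt).continuousOn
  have hF0 : (fun s => (Om (ξ₂ - s), dOm (ξ₂ - s))) 0 = 0 := by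
    simp [hOm2, hdOm2]
  have hbound : ∀ s ∈ Ico 0 (ξ₂ - ξ), ‖((-dOm (ξ₂ - s), -ddOm (ξ₂ - s)) : ℝ × ℝ)‖ ≤
      K * ‖((Om (ξ₂ - s), dOm (ξ₂ - s)) : ℝ × ℝ)‖ := by
    intro s hs
    obtain ⟨hs0, hs1⟩ := hs
    set x : ℝ := ξ₂ - s with hx
    have hxpos : 0 < x := by rw [hx]; linarith
    have hxI : x ∈ Icc ξ ξ₂ := ⟨by rw [hx]; linarith, by rw [hx]; linarith⟩
    have hxle : x ≤ ξ₂ := hxI.2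
    have hhx : |h x| ≤ B := by simpa [Real.norm_eq_abs] using hB x hxI
    set m : ℝ := ‖((Om x, dOm x) : ℝ × ℝ)‖ with hm
    have hm1 : |Om x| ≤ m := by rw [hm, Prod.norm_def]; exact le_max_left _ _
    have hm2 : |dOm x| ≤ m := by rw [hm, Prod.norm_def]; exact le_max_right _ _
    have hm0 : 0 ≤ m := norm_nonneg _
    have hdd : |ddOm x| ≤ (c + B + c / 2 * ξ₂) / ε * m := by
      have e := heq x hxpos
      have hdd' : ddOm x = (c * Om x + c / 2 * x * dOm x - h x * Om x) / ε := by
        field_simp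
        linarith
      have t1 : |c * Om x| ≤ c * m := by
        rw [abs_mul, abs_of_pos hc]; exact mul_le_mul_of_nonneg_left hm1 hc.le
      have t2 : |c / 2 * x * dOm x| ≤ c / 2 * ξ₂ * m := by
        rw [abs_mul, abs_mul, abs_of_pos (by positivity : (0:ℝ) < c / 2), abs_of_pos hxpos]
        exact mul_le_mul (mul_le_mul_of_nonneg_left hxle (by positivity)) hm2 (abs_nonneg _) (by positivity)
      have t3 : |h x * Om x| ≤ B * m := by
        rw [abs_mul]; exact mul_le_mul hhx hm1 (abs_nonneg _) hB0
      have hN : |c * Om x + c / 2 * x * dOm x - h x * Om x| ≤ (c + B + c / 2 * ξ₂) * m :=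
        calc |c * Om x + c / 2 * x * dOm x - h x * Om x|
            ≤ |c * Om x + c / 2 * x * dOm x| + |h x * Om x| := abs_sub _ _
          _ ≤ |c * Om x| + |c / 2 * x * dOm x| + |h x * Om x| := by gcongr; exact abs_add_le _ _
          _ ≤ c * m + c / 2 * ξ₂ * m + B * m := by linarith
          _ = (c + B + c / 2 * ξ₂) * m := by ring
      rw [hdd', abs_div, abs_of_pos hε]
      calc |c * Om x + c / 2 * x * dOm x - h x * Om x| / ε ≤ (c + B + c / 2 * ξ₂) * m / ε :=
            div_le_div_of_nonneg_right hN hε.le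
        _ = (c + B + c / 2 * ξ₂) / ε * m := by ring
    rw [Prod.norm_def, Real.norm_eq_abs, Real.norm_eq_abs, abs_neg, abs_neg]
    refine max_le ?_ ?_
    · calc |dOm x| ≤ m := hm2
        _ = 1 * m := (one_mul m).symm
        _ ≤ K * m := mul_le_mul_of_nonneg_right hK1 hm0
    · calc |ddOm x| ≤ (c + B + c / 2 * ξ₂) / ε * m := hdd
        _ ≤ K * m := by
            apply mul_le_mul_of_nonneg_right _ hm0
            rw [hK]; linarith
  have hres := eq_zero_of_abs_deriv_le_mul_abs_self_of_eq_zero_right hFc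
    (fun s _ => (hF s).hasDerivWithinAt) hF0 hbound (ξ₂ - ξ) (right_mem_Icc.mpr (by linarith))
  have := congrArg Prod.fst hres
  simpa using this

end SheetHalfLine
end Summit.NavierStokesRegularity.OSWSelfSimilar
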